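import Literature.NumberTheory.Rogawski1990.AdelicStableClassSupportFiniteH
import Literature.NumberTheory.Rogawski1990.StableClassHRegular
import HarnessLib

/-!
# The scalar-pair stable classes `[(ζ•1₂, u•1₁)]` of the endoscopic group `H = U(Φ₂) × U(Φ₁)` [Rogawski1990, Lemma 14.5.2 (b)]

For the CM extension `L/L⁺` and the quasi-split endoscopic group `H(L⁺) = U(Φ₂)(L⁺) × U(Φ₁)(L⁺)` of `U(3)`, the stable classes
`𝒪H = 𝒪′_st(γH)` of a pair of SCALARS `γH = (ζ•1₂, u•1₁)` with `ζ ≠ u` are exactly the classes whose image `{ζ, ζ, u}` under `ξ_H` is split-singular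
semisimple NON-central with CENTRAL `U(Φ₂)`-component — print's `γ_H` with `A_{G∕H}(γ_H) = 𝒪_st(γ₀)` at a singular non-central `γ₀` [Rogawski1990, Lemma
14.5.2 (b) p. 238], where the stable term `SJ_H(𝒪H, f^H)` of the stabilised trace formula is the MASS term `m(Z_H H_F∖H_𝐀) · f^H(γ_H)` [Prop. 10.1.2 (a)].
This leaf supplies the bookkeeping the engine line's `SJ_H` trichotomy needs at these classes:

* **`IsScalarPairClass 𝒪H`** (the predicate) with the CANONICAL scalar representative `IsScalarPairClass.rep` and its scalars `fstScalar`, `sndScalar`;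
  **`IsScalarPairClass.rep_eq`** — the scalar representative is UNIQUE (stable conjugacy in `H` is componentwise `GL`-conjugacy and a conjugate of a
  scalar is that scalar), so values read at `rep` are representative-free; `IsScalarPairClass.not_isGRegular`; `not_isScalarPairClass_of_charpoly_fst_eq`
  (an `H`-regular class `[(h₂, ·)]`, `charpoly h₂ = (X − a)(X − b)`, `a ≠ b`, is not a scalar pair).
* **`singularHyps_of_isStablyConj`** — `(γ − a)(γ − b) = 0`, «`γ` is not a scalar» and `charpoly γ` travel along stable conjugacy in `U(H)(L⁺)`
  (so the split-singular data of [Lemma 14.5.2 (b)] may be read at any representative of `𝒪_st(γ₀)`).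
* **`finite_setOf_isScalarPairClass_apply_ne_zero`** — only finitely many scalar-pair classes are met by a compactly supported `f^H` on `H(𝐀)`:
  `f^H(γH♮ ⊗ 1) ≠ 0` puts the two scalars in the finite sets `{ξ ∈ L | ξ ⊗ 1 ∈ E}` of ★ `finite_setOf_algebraMap_mem_of_isCompact`.

## References
* J. D. Rogawski, *Automorphic Representations of Unitary Groups in Three Variables*, Ann. of Math. Stud. 123 (1990), §3.1 p. 19, §4.3 p. 42,
  §5.4 pp. 72–73, Prop. 10.1.2 (a) p. 146, Lemma 14.5.2 (a)(b) p. 238 [Rogawski1990].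
* J. W. S. Cassels, A. Fröhlich (eds.), *Algebraic Number Theory* (1967), Ch. II §14 (`k` discrete in `𝔸_k`) [CasselsFrohlichANT1967].
-/

set_option autoImplicit false

noncomputable section

open NumberField IsDedekindDomain Polynomial
open scoped MatrixGroups

namespace Literature.NumberTheory.Rogawski1990

open Literature.NumberTheory.Automorphic

section General

variable {L : Type*} [Field L]

/-- `(X − a)² ∣ p ⇒ p` is not separable. [folklore] -/
private theorem not_separable_of_X_sub_C_sq_dvd' {K : Type*} [Field K] {p : Polynomial K} {a : K} (h : (Polynomial.X - Polynomial.C a) ^ 2 ∣ p) :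
    ¬ p.Separable := fun hs =>
  Polynomial.not_isUnit_X_sub_C a (hs.squarefree _ (by simpa [sq] using h))

/-- A conjugate of a scalar invertible matrix is that scalar. [folklore] -/
private theorem GL_coe_eq_smul_one_of_isConj {N : ℕ} {g g' : GL (Fin N) L} {ζ : L} (h : IsConj g g')
    (hg : ((g : GL (Fin N) L) : Matrix (Fin N) (Fin N) L) = ζ • (1 : Matrix (Fin N) (Fin N) L)) :
    ((g' : GL (Fin N) L) : Matrix (Fin N) (Fin N) L) = ζ • (1 : Matrix (Fin N) (Fin N) L) := by
  obtain ⟨c, rfl⟩ := isConj_iff.mp h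
  rw [Units.val_mul, Units.val_mul, hg, Matrix.mul_smul, Matrix.mul_one, Matrix.smul_mul, ← Units.val_mul, mul_inv_cancel, Units.val_one]

/-- `ζ • 1 = ζ′ • 1` in `M_{N+1}(L)` forces `ζ = ζ′`. [folklore] -/
private theorem smul_one_injective_matrix {N : ℕ} {ζ ζ' : L}
    (h : ζ • (1 : Matrix (Fin (N + 1)) (Fin (N + 1)) L) = ζ' • (1 : Matrix (Fin (N + 1)) (Fin (N + 1)) L)) : ζ = ζ' := by
  have h00 := congrFun (congrFun h 0) 0
  simpa using h00

end General

section CM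

variable {L : Type} [Field L] [NumberField L] [IsCMField L]


/-- A class `𝒪′_st(γH)` with `charpoly ι(γH) = charpoly γH.1 · (X − (γH.2)₀₀)` NOT separable is not `G`-regular (★ `charpoly_endoEmb`). [folklore] -/
private theorem not_isGRegular_stableClassHOf_of_not_separable'
    (γH : (UnitaryGroup.cmDatum L 2 (Matrix.of fun i j : Fin 2 => if i.val + j.val + 1 = 2 then (1 : L) else 0)).Rational ×
      (UnitaryGroup.cmDatum L 1 (Matrix.of fun i j : Fin 1 => if i.val + j.val + 1 = 1 then (1 : L) else 0)).Rational)
    (h : ¬ ((((γH.1.val : GL (Fin 2) L) : Matrix (Fin 2) (Fin 2) L).charpoly) *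
      (Polynomial.X - Polynomial.C (((γH.2.val : GL (Fin 1) L) : Matrix (Fin 1) (Fin 1) L) 0 0))).Separable) :
    ¬ (stableClassHOf (cmConjRingHom L) (Matrix.of fun i j : Fin 2 => if i.val + j.val + 1 = 2 then (1 : L) else 0)
        (Matrix.of fun i j : Fin 1 => if i.val + j.val + 1 = 1 then (1 : L) else 0) γH).IsGRegular endoForm_antidiagOne := by
  intro hreg
  rw [StableClassH.isGRegular_stableClassHOf] at hreg
  unfold IsGRegular IsRegularElt at hreg
  rw [charpoly_endoEmb] at hreg
  exact h hreg

/-- Two elements of `H(L⁺) = U(Φ₂)(L⁺) × U(Φ₁)(L⁺)` with the same matrices are equal. [cite: Rogawski1990, §3.1 p. 19] -/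
theorem HRational_ext
    {γH γH' : (UnitaryGroup.cmDatum L 2 (Matrix.of fun i j : Fin 2 => if i.val + j.val + 1 = 2 then (1 : L) else 0)).Rational × (UnitaryGroup.cmDatum L 1 (Matrix.of fun i j : Fin 1 => if i.val + j.val + 1 = 1 then (1 : L) else 0)).Rational}
    (h1 : ((γH.1.val : GL (Fin 2) L) : Matrix (Fin 2) (Fin 2) L) = ((γH'.1.val : GL (Fin 2) L) : Matrix (Fin 2) (Fin 2) L))
    (h2 : ((γH.2.val : GL (Fin 1) L) : Matrix (Fin 1) (Fin 1) L) = ((γH'.2.val : GL (Fin 1) L) : Matrix (Fin 1) (Fin 1) L)) : γH = γH' :=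
  Prod.ext (Subtype.ext (Units.ext h1)) (Subtype.ext (Units.ext h2))

/-- **THE SCALAR-PAIR CLASSES of `H(L⁺)`**: `𝒪H = 𝒪′_st(γH)` for a pair of SCALARS `γH = (ζ•1₂, u•1₁)` with `ζ ≠ u` — the classes whose image `{ζ, ζ, u}` in
`U(Φ₃)` is split-singular semisimple NON-central and whose `U(Φ₂)`-component is central (print's `γ_H` with `A_{G∕H}(γ_H) = 𝒪_st(γ₀)` at a singular `γ₀`,
[Rogawski1990, Lemma 14.5.2 (b)]); the middle case of the `SJ_H` trichotomy. [cite: Rogawski1990, Lemma 14.5.2 (b) p. 238; Prop. 10.1.2 (a) p. 146] -/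
def IsScalarPairClass (𝒪H : StableClassH (cmConjRingHom L) (Matrix.of fun i j : Fin 2 => if i.val + j.val + 1 = 2 then (1 : L) else 0) (Matrix.of fun i j : Fin 1 => if i.val + j.val + 1 = 1 then (1 : L) else 0)) : Prop :=
  ∃ (γH : (UnitaryGroup.cmDatum L 2 (Matrix.of fun i j : Fin 2 => if i.val + j.val + 1 = 2 then (1 : L) else 0)).Rational × (UnitaryGroup.cmDatum L 1 (Matrix.of fun i j : Fin 1 => if i.val + j.val + 1 = 1 then (1 : L) else 0)).Rational) (ζ u : L),
    ζ ≠ u ∧ 𝒪H = stableClassHOf (cmConjRingHom L) (Matrix.of fun i j : Fin 2 => if i.val + j.val + 1 = 2 then (1 : L) else 0) (Matrix.of fun i j : Fin 1 => if i.val + j.val + 1 = 1 then (1 : L) else 0) γH ∧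
      ((γH.1.val : GL (Fin 2) L) : Matrix (Fin 2) (Fin 2) L) = ζ • (1 : Matrix (Fin 2) (Fin 2) L) ∧
      ((γH.2.val : GL (Fin 1) L) : Matrix (Fin 1) (Fin 1) L) = u • (1 : Matrix (Fin 1) (Fin 1) L)

namespace IsScalarPairClass

variable {𝒪H : StableClassH (cmConjRingHom L) (Matrix.of fun i j : Fin 2 => if i.val + j.val + 1 = 2 then (1 : L) else 0) (Matrix.of fun i j : Fin 1 => if i.val + j.val + 1 = 1 then (1 : L) else 0)}

/-- The CANONICAL scalar-pair representative `γH♮` of a scalar-pair class (by choice; unique, `rep_eq`). [cite: Rogawski1990, Lemma 14.5.2 (b) p. 238] -/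
def rep (h : IsScalarPairClass 𝒪H) : (UnitaryGroup.cmDatum L 2 (Matrix.of fun i j : Fin 2 => if i.val + j.val + 1 = 2 then (1 : L) else 0)).Rational × (UnitaryGroup.cmDatum L 1 (Matrix.of fun i j : Fin 1 => if i.val + j.val + 1 = 1 then (1 : L) else 0)).Rational := h.choose

/-- The scalar `ζ` of the `U(Φ₂)`-component (the DOUBLE eigenvalue of the image). [cite: Rogawski1990, Lemma 14.5.2 (b) p. 238] -/
def fstScalar (h : IsScalarPairClass 𝒪H) : L := h.choose_spec.choose

/-- The scalar `u` of the `U(Φ₁)`-component (the SIMPLE eigenvalue of the image). [cite: Rogawski1990, Lemma 14.5.2 (b) p. 238] -/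
def sndScalar (h : IsScalarPairClass 𝒪H) : L := h.choose_spec.choose_spec.choose

/-- The defining properties of `(γH♮, ζ, u)`. [cite: Rogawski1990, Lemma 14.5.2 (b) p. 238] -/
theorem spec (h : IsScalarPairClass 𝒪H) : h.fstScalar ≠ h.sndScalar ∧
    𝒪H = stableClassHOf (cmConjRingHom L) (Matrix.of fun i j : Fin 2 => if i.val + j.val + 1 = 2 then (1 : L) else 0) (Matrix.of fun i j : Fin 1 => if i.val + j.val + 1 = 1 then (1 : L) else 0) h.rep ∧
    ((h.rep.1.val : GL (Fin 2) L) : Matrix (Fin 2) (Fin 2) L) = h.fstScalar • (1 : Matrix (Fin 2) (Fin 2) L) ∧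
    ((h.rep.2.val : GL (Fin 1) L) : Matrix (Fin 1) (Fin 1) L) = h.sndScalar • (1 : Matrix (Fin 1) (Fin 1) L) :=
  h.choose_spec.choose_spec.choose_spec

/-- **Uniqueness of the scalar representative**: ANY representative `γH = (a•1₂, b•1₁)` of a scalar-pair class IS `γH♮`, with `a = ζ`, `b = u` (stable conjugacy
in `H` is componentwise `GL`-conjugacy, and a conjugate of a scalar is that scalar). [cite: Rogawski1990, §3.1 p. 19] -/
theorem rep_eq (h : IsScalarPairClass 𝒪H)
    {γH : (UnitaryGroup.cmDatum L 2 (Matrix.of fun i j : Fin 2 => if i.val + j.val + 1 = 2 then (1 : L) else 0)).Rational × (UnitaryGroup.cmDatum L 1 (Matrix.of fun i j : Fin 1 => if i.val + j.val + 1 = 1 then (1 : L) else 0)).Rational} {a b : L}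
    (he : 𝒪H = stableClassHOf (cmConjRingHom L) (Matrix.of fun i j : Fin 2 => if i.val + j.val + 1 = 2 then (1 : L) else 0) (Matrix.of fun i j : Fin 1 => if i.val + j.val + 1 = 1 then (1 : L) else 0) γH)
    (h1 : ((γH.1.val : GL (Fin 2) L) : Matrix (Fin 2) (Fin 2) L) = a • (1 : Matrix (Fin 2) (Fin 2) L))
    (h2 : ((γH.2.val : GL (Fin 1) L) : Matrix (Fin 1) (Fin 1) L) = b • (1 : Matrix (Fin 1) (Fin 1) L)) :
    h.rep = γH ∧ h.fstScalar = a ∧ h.sndScalar = b := by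
  obtain ⟨-, he', h1', h2'⟩ := h.spec
  have hst : IsStablyConjH (cmConjRingHom L) (Matrix.of fun i j : Fin 2 => if i.val + j.val + 1 = 2 then (1 : L) else 0) (Matrix.of fun i j : Fin 1 => if i.val + j.val + 1 = 1 then (1 : L) else 0) h.rep γH :=
    stableClassHOf_eq_iff.mp (he'.symm.trans he)
  have e1 : ((γH.1.val : GL (Fin 2) L) : Matrix (Fin 2) (Fin 2) L) = h.fstScalar • (1 : Matrix (Fin 2) (Fin 2) L) :=
    GL_coe_eq_smul_one_of_isConj hst.1 h1'
  have e2 : ((γH.2.val : GL (Fin 1) L) : Matrix (Fin 1) (Fin 1) L) = h.sndScalar • (1 : Matrix (Fin 1) (Fin 1) L) :=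
    GL_coe_eq_smul_one_of_isConj hst.2 h2'
  refine ⟨HRational_ext (h1'.trans e1.symm) (h2'.trans e2.symm), smul_one_injective_matrix (e1.symm.trans h1),
    smul_one_injective_matrix (e2.symm.trans h2)⟩

/-- A scalar-pair class is NOT `G`-regular (`charpoly ι(γH♮) = (X − ζ)² (X − u)`). [cite: Rogawski1990, §4.3 p. 42] -/
theorem not_isGRegular (h : IsScalarPairClass 𝒪H) : ¬ 𝒪H.IsGRegular endoForm_antidiagOne := by
  obtain ⟨-, he, h1, -⟩ := h.spec
  rw [he]
  refine not_isGRegular_stableClassHOf_of_not_separable' h.rep (not_separable_of_X_sub_C_sq_dvd' (a := h.fstScalar) ?_)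
  have h1' : (((h.rep.1.val : GL (Fin 2) L) : Matrix (Fin 2) (Fin 2) L).charpoly) = (Polynomial.X - Polynomial.C h.fstScalar) ^ 2 := by
    rw [h1, Matrix.smul_one_eq_diagonal, Matrix.charpoly_diagonal, Finset.prod_const, Finset.card_univ, Fintype.card_fin]
  rw [h1']
  exact Dvd.intro _ rfl

end IsScalarPairClass

/-- An `H`-REGULAR class `[(h₂, ·)]` (`charpoly h₂ = (X − a)(X − b)`, `a ≠ b`) is not a scalar-pair class. [cite: Rogawski1990, Lemma 14.5.2 (a) p. 238] -/
theorem not_isScalarPairClass_of_charpoly_fst_eq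
    {𝒪H : StableClassH (cmConjRingHom L) (Matrix.of fun i j : Fin 2 => if i.val + j.val + 1 = 2 then (1 : L) else 0) (Matrix.of fun i j : Fin 1 => if i.val + j.val + 1 = 1 then (1 : L) else 0)}
    {γH : (UnitaryGroup.cmDatum L 2 (Matrix.of fun i j : Fin 2 => if i.val + j.val + 1 = 2 then (1 : L) else 0)).Rational × (UnitaryGroup.cmDatum L 1 (Matrix.of fun i j : Fin 1 => if i.val + j.val + 1 = 1 then (1 : L) else 0)).Rational} {a b : L}
    (he : 𝒪H = stableClassHOf (cmConjRingHom L) (Matrix.of fun i j : Fin 2 => if i.val + j.val + 1 = 2 then (1 : L) else 0) (Matrix.of fun i j : Fin 1 => if i.val + j.val + 1 = 1 then (1 : L) else 0) γH) (hab : a ≠ b)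
    (hchar : ((γH.1.val : GL (Fin 2) L) : Matrix (Fin 2) (Fin 2) L).charpoly = (Polynomial.X - Polynomial.C a) * (Polynomial.X - Polynomial.C b)) :
    ¬ IsScalarPairClass 𝒪H := by
  intro h
  obtain ⟨-, he', h1', -⟩ := h.spec
  have hst : IsStablyConjH (cmConjRingHom L) (Matrix.of fun i j : Fin 2 => if i.val + j.val + 1 = 2 then (1 : L) else 0) (Matrix.of fun i j : Fin 1 => if i.val + j.val + 1 = 1 then (1 : L) else 0) h.rep γH :=
    stableClassHOf_eq_iff.mp (he'.symm.trans he)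
  have e1 : ((γH.1.val : GL (Fin 2) L) : Matrix (Fin 2) (Fin 2) L) = h.fstScalar • (1 : Matrix (Fin 2) (Fin 2) L) :=
    GL_coe_eq_smul_one_of_isConj hst.1 h1'
  rw [e1, Matrix.smul_one_eq_diagonal, Matrix.charpoly_diagonal, Finset.prod_const, Finset.card_univ, Fintype.card_fin] at hchar
  have ha := congrArg (Polynomial.eval a) hchar
  have hb := congrArg (Polynomial.eval b) hchar
  simp only [Polynomial.eval_pow, Polynomial.eval_sub, Polynomial.eval_X, Polynomial.eval_C, Polynomial.eval_mul, sub_self, zero_mul,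
    mul_zero, pow_eq_zero_iff, ne_eq, OfNat.ofNat_ne_zero, not_false_eq_true, sub_eq_zero] at ha hb
  exact hab (ha.trans hb.symm)

/-- **Transport of the split-singular data along stable conjugacy**: `(γ − a)(γ − b) = 0`, «`γ` not a scalar» and `charpoly γ` are invariant under
`GL₃(L)`-conjugacy. [cite: Rogawski1990, §3.1 p. 19] -/
theorem singularHyps_of_isStablyConj {H : Matrix (Fin 3) (Fin 3) L} {γ δ : (UnitaryGroup.cmDatum L 3 H).Rational}
    (h : IsStablyConj (cmConjRingHom L) H γ δ) {a b : L}
    (hγ : (((γ.val : GL (Fin 3) L) : Matrix (Fin 3) (Fin 3) L) - a • (1 : Matrix (Fin 3) (Fin 3) L)) *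
      (((γ.val : GL (Fin 3) L) : Matrix (Fin 3) (Fin 3) L) - b • (1 : Matrix (Fin 3) (Fin 3) L)) = 0)
    (hnc : ¬ ∃ ζ : L, ((γ.val : GL (Fin 3) L) : Matrix (Fin 3) (Fin 3) L) = ζ • (1 : Matrix (Fin 3) (Fin 3) L)) :
    (((δ.val : GL (Fin 3) L) : Matrix (Fin 3) (Fin 3) L) - a • (1 : Matrix (Fin 3) (Fin 3) L)) *
        (((δ.val : GL (Fin 3) L) : Matrix (Fin 3) (Fin 3) L) - b • (1 : Matrix (Fin 3) (Fin 3) L)) = 0 ∧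
      (¬ ∃ ζ : L, ((δ.val : GL (Fin 3) L) : Matrix (Fin 3) (Fin 3) L) = ζ • (1 : Matrix (Fin 3) (Fin 3) L)) ∧
      ((δ.val : GL (Fin 3) L) : Matrix (Fin 3) (Fin 3) L).charpoly = ((γ.val : GL (Fin 3) L) : Matrix (Fin 3) (Fin 3) L).charpoly := by
  refine ⟨?_, fun ⟨ζ, hζ⟩ => hnc ⟨ζ, GL_coe_eq_smul_one_of_isConj h.symm hζ⟩, (IsStablyConj.charpoly_eq h).symm⟩
  obtain ⟨c, hc⟩ := isConj_iff.mp h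
  have hδ : ((δ.val : GL (Fin 3) L) : Matrix (Fin 3) (Fin 3) L) =
      (c : Matrix (Fin 3) (Fin 3) L) * ((γ.val : GL (Fin 3) L) : Matrix (Fin 3) (Fin 3) L) * ((c⁻¹ : GL (Fin 3) L) : Matrix (Fin 3) (Fin 3) L) := by
    rw [← Units.val_mul, ← Units.val_mul]
    exact congrArg (fun u : GL (Fin 3) L => (u : Matrix (Fin 3) (Fin 3) L)) hc.symm
  have hcc : ((c⁻¹ : GL (Fin 3) L) : Matrix (Fin 3) (Fin 3) L) * (c : Matrix (Fin 3) (Fin 3) L) = 1 := by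
    rw [← Units.val_mul, inv_mul_cancel, Units.val_one]
  have hcc' : (c : Matrix (Fin 3) (Fin 3) L) * ((c⁻¹ : GL (Fin 3) L) : Matrix (Fin 3) (Fin 3) L) = 1 := by
    rw [← Units.val_mul, mul_inv_cancel, Units.val_one]
  have key : ∀ e : L, ((δ.val : GL (Fin 3) L) : Matrix (Fin 3) (Fin 3) L) - e • (1 : Matrix (Fin 3) (Fin 3) L) =
      (c : Matrix (Fin 3) (Fin 3) L) * (((γ.val : GL (Fin 3) L) : Matrix (Fin 3) (Fin 3) L) - e • (1 : Matrix (Fin 3) (Fin 3) L)) *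
        ((c⁻¹ : GL (Fin 3) L) : Matrix (Fin 3) (Fin 3) L) := fun e => by
    rw [Matrix.mul_sub, Matrix.sub_mul, Matrix.mul_smul, Matrix.mul_one, Matrix.smul_mul, hcc', hδ]
  rw [key a, key b]
  calc (c : Matrix (Fin 3) (Fin 3) L) * (((γ.val : GL (Fin 3) L) : Matrix (Fin 3) (Fin 3) L) - a • (1 : Matrix (Fin 3) (Fin 3) L)) *
          ((c⁻¹ : GL (Fin 3) L) : Matrix (Fin 3) (Fin 3) L) *
        ((c : Matrix (Fin 3) (Fin 3) L) * (((γ.val : GL (Fin 3) L) : Matrix (Fin 3) (Fin 3) L) - b • (1 : Matrix (Fin 3) (Fin 3) L)) *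
          ((c⁻¹ : GL (Fin 3) L) : Matrix (Fin 3) (Fin 3) L))
        = (c : Matrix (Fin 3) (Fin 3) L) * ((((γ.val : GL (Fin 3) L) : Matrix (Fin 3) (Fin 3) L) - a • (1 : Matrix (Fin 3) (Fin 3) L)) *
            ((((c⁻¹ : GL (Fin 3) L) : Matrix (Fin 3) (Fin 3) L) * (c : Matrix (Fin 3) (Fin 3) L)) *
              (((γ.val : GL (Fin 3) L) : Matrix (Fin 3) (Fin 3) L) - b • (1 : Matrix (Fin 3) (Fin 3) L)))) *
          ((c⁻¹ : GL (Fin 3) L) : Matrix (Fin 3) (Fin 3) L) := by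
          simp only [Matrix.mul_assoc]
    _ = 0 := by rw [hcc, Matrix.one_mul, hγ, Matrix.mul_zero, Matrix.zero_mul]

/-- **Only finitely many scalar-pair classes are met by a test function**: `f^H(γH♮ ⊗ 1) ≠ 0` puts `γH♮ ⊗ 1` in the compact `tsupport f^H`, so the two scalars
`(ζ, u)` — the `(0,0)`-entries of the two components of `γH♮ ⊗ 1` — lie in the finite sets `{ξ ∈ L | ξ ⊗ 1 ∈ E}` (★ `finite_setOf_algebraMap_mem_of_isCompact`,
`E` a continuous image of `tsupport f^H`), and `(ζ, u)` determines the class. [cite: CasselsFrohlichANT1967, Ch. II §14] [cite: Rogawski1990, §5.4 pp. 72–73] -/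
theorem finite_setOf_isScalarPairClass_apply_ne_zero (fH : CompactlySupportedContinuousMap ((UnitaryGroup.cmDatum L 2 (Matrix.of fun i j : Fin 2 => if i.val + j.val + 1 = 2 then (1 : L) else 0)).Adelic × (UnitaryGroup.cmDatum L 1 (Matrix.of fun i j : Fin 1 => if i.val + j.val + 1 = 1 then (1 : L) else 0)).Adelic) ℂ) :
    {𝒪H : StableClassH (cmConjRingHom L) (Matrix.of fun i j : Fin 2 => if i.val + j.val + 1 = 2 then (1 : L) else 0) (Matrix.of fun i j : Fin 1 => if i.val + j.val + 1 = 1 then (1 : L) else 0) |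
      ∃ h : IsScalarPairClass 𝒪H,
        fH (((UnitaryGroup.cmDatum L 2 (Matrix.of fun i j : Fin 2 => if i.val + j.val + 1 = 2 then (1 : L) else 0)).toAdelic h.rep.1, (UnitaryGroup.cmDatum L 1 (Matrix.of fun i j : Fin 1 => if i.val + j.val + 1 = 1 then (1 : L) else 0)).toAdelic h.rep.2)) ≠ 0}.Finite := by
  classical
  have hE : IsCompact (tsupport ⇑fH) := fH.hasCompactSupport
  have hφ₁ : Continuous fun x : ((UnitaryGroup.cmDatum L 2 (Matrix.of fun i j : Fin 2 => if i.val + j.val + 1 = 2 then (1 : L) else 0)).Adelic × (UnitaryGroup.cmDatum L 1 (Matrix.of fun i j : Fin 1 => if i.val + j.val + 1 = 1 then (1 : L) else 0)).Adelic) =>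
      ((x.1.val : GL (Fin 2) (AdeleRing (𝓞 L) L)) : Matrix (Fin 2) (Fin 2) (AdeleRing (𝓞 L) L)) 0 0 :=
    (Units.continuous_val.comp (continuous_subtype_val.comp continuous_fst)).matrix_elem 0 0
  have hφ₂ : Continuous fun x : ((UnitaryGroup.cmDatum L 2 (Matrix.of fun i j : Fin 2 => if i.val + j.val + 1 = 2 then (1 : L) else 0)).Adelic × (UnitaryGroup.cmDatum L 1 (Matrix.of fun i j : Fin 1 => if i.val + j.val + 1 = 1 then (1 : L) else 0)).Adelic) =>
      ((x.2.val : GL (Fin 1) (AdeleRing (𝓞 L) L)) : Matrix (Fin 1) (Fin 1) (AdeleRing (𝓞 L) L)) 0 0 :=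
    (Units.continuous_val.comp (continuous_subtype_val.comp continuous_snd)).matrix_elem 0 0
  have hF₁ := finite_setOf_algebraMap_mem_of_isCompact (hE.image hφ₁)
  have hF₂ := finite_setOf_algebraMap_mem_of_isCompact (hE.image hφ₂)
  let Ψ : StableClassH (cmConjRingHom L) (Matrix.of fun i j : Fin 2 => if i.val + j.val + 1 = 2 then (1 : L) else 0) (Matrix.of fun i j : Fin 1 => if i.val + j.val + 1 = 1 then (1 : L) else 0) → L × L :=
    fun 𝒪H => if h : IsScalarPairClass 𝒪H then (h.fstScalar, h.sndScalar) else 0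
  refine Set.Finite.of_finite_image (f := Ψ) ((hF₁.prod hF₂).subset ?_) ?_
  · rintro _ ⟨𝒪H, ⟨h, hne⟩, rfl⟩
    obtain ⟨-, -, h1, h2⟩ := h.spec
    have hx := subset_tsupport _ (Function.mem_support.mpr hne)
    simp only [Ψ, dif_pos h, Set.mem_prod, Set.mem_setOf_eq]
    refine ⟨⟨_, hx, ?_⟩, ⟨_, hx, ?_⟩⟩
    · show ((((UnitaryGroup.cmDatum L 2 (Matrix.of fun i j : Fin 2 => if i.val + j.val + 1 = 2 then (1 : L) else 0)).toAdelic h.rep.1).val : GL (Fin 2) (AdeleRing (𝓞 L) L)) :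
          Matrix (Fin 2) (Fin 2) (AdeleRing (𝓞 L) L)) 0 0 = algebraMap L (AdeleRing (𝓞 L) L) h.fstScalar
      rw [coe_coe_cmDatum_toAdelic_apply]
      rw [h1, Matrix.smul_apply, Matrix.one_apply_eq, smul_eq_mul, mul_one]
    · show ((((UnitaryGroup.cmDatum L 1 (Matrix.of fun i j : Fin 1 => if i.val + j.val + 1 = 1 then (1 : L) else 0)).toAdelic h.rep.2).val : GL (Fin 1) (AdeleRing (𝓞 L) L)) :
          Matrix (Fin 1) (Fin 1) (AdeleRing (𝓞 L) L)) 0 0 = algebraMap L (AdeleRing (𝓞 L) L) h.sndScalar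
      rw [coe_coe_cmDatum_toAdelic_apply]
      rw [h2, Matrix.smul_apply, Matrix.one_apply_eq, smul_eq_mul, mul_one]
  · rintro 𝒪H ⟨h, -⟩ 𝒪H' ⟨h', -⟩ hΨ
    simp only [Ψ, dif_pos h, dif_pos h', Prod.mk.injEq] at hΨ
    obtain ⟨-, he, h1, h2⟩ := h.spec
    obtain ⟨-, he', h1', h2'⟩ := h'.spec
    rw [he, he', HRational_ext (h1.trans ((congrArg (· • (1 : Matrix (Fin 2) (Fin 2) L)) hΨ.1).trans h1'.symm))
      (h2.trans ((congrArg (· • (1 : Matrix (Fin 1) (Fin 1) L)) hΨ.2).trans h2'.symm))]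

end CM

end Literature.NumberTheory.Rogawski1990

end
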